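import Summits.AtomisticToContinuum.Crystallization.Theorems.ReggeStarCoercivityDefectFreeCrystallizesRouteBetaPricedFloor
import Summits.AtomisticToContinuum.Crystallization.Theorems.ReggeStarCoercivityDefectFreeCrystallizesCovariantMecke
import Summits.AtomisticToContinuum.Crystallization.Theorems.ReggeStarCoercivityDefectFreeCrystallizesMarkMeasurable
import Summits.AtomisticToContinuum.Crystallization.Theorems.ReggeStarCoercivityDefectFreeCrystallizesLevelPricing
import Summits.AtomisticToContinuum.Crystallization.Theorems.ReggeStarCoercivityDefectFreeCrystallizesTwelveNeighbours

/-!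
# Route β of line `palm-good-law`, LAW-FREE form (crux `ReggeStarCoercivity.DefectFreeCrystallizes`,
# item stmt-AtomisticToContinuum-13603; lead c7, skeleton v22/v23)

The priced funnel floor (`RouteBetaPricedFloor`, hypothesis `hfloor` there: `hcpE a₀ h₀ + κ·P(bad root shell) ≤ E_P[h]` for every
point-stationary rooted hard-core law a.s. carried by everywhere-`SetGood` Barlow-charted force-balanced configurations with zero mean
virial stress) is reduced, sorry-free, to a POINTWISE, CHART-FREE CERTIFICATE FAMILY on single configurations (hypothesis `hcert`
below, the registered stub `stub_funnelCertificate` of the skeleton — the line's one law-free analytic core) by four generic tools landed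
this cycle:

* `CovariantMecke.stub_covariantMecke` — Mecke with a translation-covariant mark: `E_P[Σ_y w(y) 1_C(μ,y)] = E_P[1_C(μ,0)·∫ w dμ]`;
* `MarkMeasurable.stub_markMeasurable` — Giry-measurable versions of mark functionals `μ ↦ ∫ k(μ,y) dμ(y)` on hard-core configurations;
* `LevelPricing.stub_levelPricing` — Mecke pricing of an a.s. pointwise certificate with a `P`-integrable LEVEL FUNCTION;
* `TwelveNeighbours.stub_twelveNeighbours` — a `SetGood` root has exactly twelve points in its punctured open `6/5`-ball.

WHY the law can be eliminated (lead c7): the floor = Hägg selection at fixed geometry + word-uniform funnel rigidity around the IDEAL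
own-word reference with PER-FAULT slack (the reference's relaxation energy, `≤ 6.2e-8` per c-layer by the lead's numerics, against a letter
price `≈ 7e-5`).  Selection is SITEWISE (the landed column `PricedHcpWindowsSiteEnergyColumn.stub_siteEnergyColumn` of crux 14993: deficit
`½(|J₂|−|J₃|)` per misaligned side), and at the root the number of misaligned sides is `(#cubic neighbours − 6·[root cubic])/3` — intrinsic —
while `E_P[#cubic neighbours] = 12·P(root cubic)` is ONE covariant Mecke step.  So the certificate's level function
`ℓ_ε(μ) = hcpE a₀ h₀ − ε + α·#(marked 6/5-neighbours) − β·[root marked] − Σ_(marked y) w(y)` has `E_P[ℓ_ε] ≥ hcpE a₀ h₀ − ε` as soon as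
`β + W ≤ 12α` (`∫ w dμ ≤ W`), whatever the (covariant, jointly measurable) mark is.

Main results: `pricedFloor_of_funnelCertificates` (anchor; certificate family ⇒ priced floor) and
`defectFreeCrystallizes_of_funnelCertificates` (certificate family → crux 9226 → the crux BY NAME): the crux is CLOSED MODULO
{`stub_funnelCertificate`, crux 9226} in the tree.  All `[folklore]` bookkeeping; no definitions.
-/

noncomputable section

open scoped ENNReal
open Filter Topology MeasureTheory

namespace Summit.AtomisticToContinuum.Crystallization.Theorems.PalmGoodLaw.RouteBetaLawFree

open Summit.AtomisticToContinuum.Crystallization.Theses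
open Summit.AtomisticToContinuum.Crystallization.Theorems.PalmUnimodularRigidity
open Literature.MathematicalPhysics.StatisticalMechanics Literature.Geometry.DiscreteGeometry
open Literature.Probability.Process

/-- The indicator of the punctured open `6/5`-ball is even (anchor of this file; used for the neighbour-count mark). [folklore] -/
theorem shellIndicator_neg :
    ∀ y : EuclideanSpace ℝ (Fin 3), ({z : EuclideanSpace ℝ (Fin 3) | 0 < ‖z‖ ∧ ‖z‖ < 6 / 5}).indicator (fun _ => (1 : ℝ≥0∞)) (-y) =
      ({z : EuclideanSpace ℝ (Fin 3) | 0 < ‖z‖ ∧ ‖z‖ < 6 / 5}).indicator (fun _ => (1 : ℝ≥0∞)) y := by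
  intro y
  have hmem : (-y ∈ {z : EuclideanSpace ℝ (Fin 3) | 0 < ‖z‖ ∧ ‖z‖ < 6 / 5}) ↔
      (y ∈ {z : EuclideanSpace ℝ (Fin 3) | 0 < ‖z‖ ∧ ‖z‖ < 6 / 5}) := by
    simp only [Set.mem_setOf_eq, norm_neg]
  by_cases hy : y ∈ {z : EuclideanSpace ℝ (Fin 3) | 0 < ‖z‖ ∧ ‖z‖ < 6 / 5}
  · rw [Set.indicator_of_mem hy, Set.indicator_of_mem (hmem.2 hy)]
  · rw [Set.indicator_of_notMem hy, Set.indicator_of_notMem (fun h => hy (hmem.1 h))]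

/-- **Pointwise chart-free funnel certificates ⇒ the priced funnel floor**.  If for the relaxed reference
`(a₀,h₀)` there is a price `κ > 0` such that for every hard core `δ > 0` there are a jointly measurable root-covariant mark `C`, an even
measurable weight `w` with `∫ w dμ ≤ W` on rooted `δ`-hard-core configurations, and coefficients `α, β ≥ 0` with `β + W ≤ 12α`, such
that for every `ε > 0` a bounded finite-range jointly measurable bond transfer `t` certifies on EVERY rooted `δ`-hard-core
everywhere-`SetGood` Barlow-charted force-balanced configuration `ℓ_ε(μ) ≤ h(μ) + div t(μ)`, and `ℓ_ε(μ) + κ ≤ h(μ) + div t(μ)` when the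
root shell is not `1 %`-good (`ℓ_ε` as in the module docstring), then `hcpE a₀ h₀ + κ·P(bad) ≤ E_P[h]` for every point-stationary rooted
`δ`-hard-core law a.s. carried by such configurations (the zero-mean-stress hypothesis of the floor is not even used).  Proof: `ℓ_ε` is
`P`-integrable (measurable versions, twelve neighbours, `∫ w ≤ W`); level pricing gives `E_P[ℓ_ε] + κ·P*(bad) ≤ E_P[h]`; covariant Mecke
gives `E_P[ℓ_ε] ≥ hcpE − ε + (12α − β − W)·P(root marked) ≥ hcpE − ε`; `ε → 0`. [folklore] -/
theorem pricedFloor_of_funnelCertificates :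
    (∀ a₀ h₀ : ℝ, 189 / 200 ≤ a₀ → a₀ ≤ 199 / 200 → 77 / 100 ≤ h₀ → h₀ ≤ 163 / 200 →
          (∀ a h : ℝ, 0 < a → 0 < h →
            Summit.AtomisticToContinuum.Crystallization.Theorems.PalmUnimodularRigidity.LayeredLawsSelectHcp.hcpE a₀ h₀ ≤
              Summit.AtomisticToContinuum.Crystallization.Theorems.PalmUnimodularRigidity.LayeredLawsSelectHcp.hcpE a h) →
          ∃ κ : ℝ, 0 < κ ∧ ∀ δ : ℝ, 0 < δ →
            ∃ (C : Set (Measure (EuclideanSpace ℝ (Fin 3)) × EuclideanSpace ℝ (Fin 3)))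
              (w : EuclideanSpace ℝ (Fin 3) → ℝ≥0∞) (α β W : ℝ),
              MeasurableSet C ∧
              (∀ (μ : Measure (EuclideanSpace ℝ (Fin 3))) (y : EuclideanSpace ℝ (Fin 3)),
                (Measure.map (fun z => z - y) μ, -y) ∈ C ↔ (μ, (0 : EuclideanSpace ℝ (Fin 3))) ∈ C) ∧
              Measurable w ∧ (∀ y, w (-y) = w y) ∧ 0 ≤ W ∧
              (∀ μ : Measure (EuclideanSpace ℝ (Fin 3)), IsRootedHardCore δ μ → ∫⁻ y, w y ∂μ ≤ ENNReal.ofReal W) ∧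
              0 ≤ α ∧ 0 ≤ β ∧ β + W ≤ 12 * α ∧
              ∀ ε : ℝ, 0 < ε →
                ∃ R M : ℝ, ∃ t : Measure (EuclideanSpace ℝ (Fin 3)) → EuclideanSpace ℝ (Fin 3) → ℝ,
                  (Measurable (Function.uncurry t) ∧ (∀ μ y, |t μ y| ≤ M) ∧ ∀ μ y, R < ‖y‖ → t μ y = 0) ∧
                  ∀ μ : Measure (EuclideanSpace ℝ (Fin 3)), IsRootedHardCore δ μ →
                    (∃ S : Set (EuclideanSpace ℝ (Fin 3)),
                      μ = (Measure.count : Measure (EuclideanSpace ℝ (Fin 3))).restrict S ∧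
                      (∀ y ∈ S, SetGood S y) ∧
                      ∃ s : ℤ → ℤ, IsHaggSeq s ∧
                        ∃ Φ : EuclideanSpace ℝ (Fin 3) → EuclideanSpace ℝ (Fin 3),
                          Set.BijOn Φ (barlowStacking 1 (Real.sqrt (2 / 3)) s) S ∧
                          ∀ p ∈ barlowStacking 1 (Real.sqrt (2 / 3)) s, ∀ q ∈ barlowStacking 1 (Real.sqrt (2 / 3)) s,
                            (dist p q = 1 ↔ (0 < dist (Φ p) (Φ q) ∧ dist (Φ p) (Φ q) < 6 / 5))) →
                    (∃ S : Set (EuclideanSpace ℝ (Fin 3)),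
                      μ = (Measure.count : Measure (EuclideanSpace ℝ (Fin 3))).restrict S ∧
                      ∀ p ∈ S, HasSum (fun q : {q : EuclideanSpace ℝ (Fin 3) // q ∈ S ∧ q ≠ p} =>
                        (deriv lennardJones (dist p q.1) / dist p q.1) • (p - q.1)) 0) →
                    (Summit.AtomisticToContinuum.Crystallization.Theorems.PalmUnimodularRigidity.LayeredLawsSelectHcp.hcpE a₀ h₀ - ε +
                          α * (∫⁻ y, C.indicator (fun p => ({z : EuclideanSpace ℝ (Fin 3) | 0 < ‖z‖ ∧ ‖z‖ < 6 / 5}).indicator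
                            (fun _ => (1 : ℝ≥0∞)) p.2) (μ, y) ∂μ).toReal -
                          {μ' : Measure (EuclideanSpace ℝ (Fin 3)) | (μ', (0 : EuclideanSpace ℝ (Fin 3))) ∈ C}.indicator
                            (fun _ => β) μ -
                          (∫⁻ y, C.indicator (fun p => w p.2) (μ, y) ∂μ).toReal ≤
                        (∫ y, lennardJones ‖y‖ ∂μ) / 2 + ∫ y, (t μ y - t (Measure.map (fun z => z - y) μ) (-y)) ∂μ) ∧
                    ((¬ ∃ a : ℝ, 9 / 10 ≤ a ∧ a ≤ 1 ∧ ∃ T : Finset (EuclideanSpace ℝ (Fin 3)),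
                        (↑T : Set (EuclideanSpace ℝ (Fin 3))) =
                          {y : EuclideanSpace ℝ (Fin 3) | μ {y} ≠ 0 ∧ y ≠ 0 ∧ ‖y‖ ≤ 5 / 4 * a} ∧
                        (ShellCloseTo (a / 100) T (Finset.image (fun v : EuclideanSpace ℝ (Fin 3) => a • v) fccKissingPattern) ∨
                          ShellCloseTo (a / 100) T
                            (Finset.image (fun v : EuclideanSpace ℝ (Fin 3) => a • v) hcpKissingPattern))) →
                      Summit.AtomisticToContinuum.Crystallization.Theorems.PalmUnimodularRigidity.LayeredLawsSelectHcp.hcpE a₀ h₀ - ε +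
                            α * (∫⁻ y, C.indicator (fun p => ({z : EuclideanSpace ℝ (Fin 3) | 0 < ‖z‖ ∧ ‖z‖ < 6 / 5}).indicator
                              (fun _ => (1 : ℝ≥0∞)) p.2) (μ, y) ∂μ).toReal -
                            {μ' : Measure (EuclideanSpace ℝ (Fin 3)) | (μ', (0 : EuclideanSpace ℝ (Fin 3))) ∈ C}.indicator
                              (fun _ => β) μ -
                            (∫⁻ y, C.indicator (fun p => w p.2) (μ, y) ∂μ).toReal + κ ≤
                        (∫ y, lennardJones ‖y‖ ∂μ) / 2 + ∫ y, (t μ y - t (Measure.map (fun z => z - y) μ) (-y)) ∂μ)) →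
        ∀ a₀ h₀ : ℝ, 189 / 200 ≤ a₀ → a₀ ≤ 199 / 200 → 77 / 100 ≤ h₀ → h₀ ≤ 163 / 200 →
          (∀ a h : ℝ, 0 < a → 0 < h →
            Summit.AtomisticToContinuum.Crystallization.Theorems.PalmUnimodularRigidity.LayeredLawsSelectHcp.hcpE a₀ h₀ ≤
              Summit.AtomisticToContinuum.Crystallization.Theorems.PalmUnimodularRigidity.LayeredLawsSelectHcp.hcpE a h) →
          ∀ δ : ℝ, 0 < δ → ∃ κ : ℝ, 0 < κ ∧ ∀ P : Measure (Measure (EuclideanSpace ℝ (Fin 3))), IsProbabilityMeasure P →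
            (∀ᵐ μ ∂P, IsRootedHardCore δ μ) → IsPointStationaryLaw P →
            (∀ᵐ μ ∂P, ∃ S : Set (EuclideanSpace ℝ (Fin 3)),
              μ = (Measure.count : Measure (EuclideanSpace ℝ (Fin 3))).restrict S ∧
              (∀ y ∈ S, SetGood S y) ∧
              ∃ s : ℤ → ℤ, IsHaggSeq s ∧
                ∃ Φ : EuclideanSpace ℝ (Fin 3) → EuclideanSpace ℝ (Fin 3),
                  Set.BijOn Φ (barlowStacking 1 (Real.sqrt (2 / 3)) s) S ∧
                  ∀ p ∈ barlowStacking 1 (Real.sqrt (2 / 3)) s, ∀ q ∈ barlowStacking 1 (Real.sqrt (2 / 3)) s,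
                    (dist p q = 1 ↔ (0 < dist (Φ p) (Φ q) ∧ dist (Φ p) (Φ q) < 6 / 5))) →
            (∀ᵐ μ ∂P, ∃ S : Set (EuclideanSpace ℝ (Fin 3)),
              μ = (Measure.count : Measure (EuclideanSpace ℝ (Fin 3))).restrict S ∧
              ∀ p ∈ S, HasSum (fun q : {q : EuclideanSpace ℝ (Fin 3) // q ∈ S ∧ q ≠ p} =>
                (deriv lennardJones (dist p q.1) / dist p q.1) • (p - q.1)) 0) →
            (∀ M : EuclideanSpace ℝ (Fin 3) →L[ℝ] EuclideanSpace ℝ (Fin 3),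
              ∫ μ, (∫ y, deriv lennardJones ‖y‖ / ‖y‖ * inner ℝ y (M y) ∂μ) ∂P = 0) →
            Summit.AtomisticToContinuum.Crystallization.Theorems.PalmUnimodularRigidity.LayeredLawsSelectHcp.hcpE a₀ h₀ +
                κ * (P {μ | ¬ ∃ a : ℝ, 9 / 10 ≤ a ∧ a ≤ 1 ∧ ∃ T : Finset (EuclideanSpace ℝ (Fin 3)),
                  (↑T : Set (EuclideanSpace ℝ (Fin 3))) =
                    {y : EuclideanSpace ℝ (Fin 3) | μ {y} ≠ 0 ∧ y ≠ 0 ∧ ‖y‖ ≤ 5 / 4 * a} ∧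
                  (ShellCloseTo (a / 100) T (Finset.image (fun v : EuclideanSpace ℝ (Fin 3) => a • v) fccKissingPattern) ∨
                    ShellCloseTo (a / 100) T
                      (Finset.image (fun v : EuclideanSpace ℝ (Fin 3) => a • v) hcpKissingPattern))}).toReal ≤
              ∫ μ, (∫ y, lennardJones ‖y‖ ∂μ) / 2 ∂P  := by
  intro hcert a₀ h₀ ha₁ ha₂ hh₁ hh₂ hmin δ hδ
  obtain ⟨κ, hκ, hB⟩ := hcert a₀ h₀ ha₁ ha₂ hh₁ hh₂ hmin
  obtain ⟨C, w, α, β, W, hCm, hCcov, hwm, hweven, hW0, hwW, hα, hβ, hside, hcertε⟩ := hB δ hδ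
  refine ⟨κ, hκ, fun P hP hcore hstat hchart hFB _hZS => ?_⟩
  -- abbreviations
  set level : ℝ :=
    Summit.AtomisticToContinuum.Crystallization.Theorems.PalmUnimodularRigidity.LayeredLawsSelectHcp.hcpE a₀ h₀ with hlevel
  set shellInd : EuclideanSpace ℝ (Fin 3) → ℝ≥0∞ :=
    ({z : EuclideanSpace ℝ (Fin 3) | 0 < ‖z‖ ∧ ‖z‖ < 6 / 5}).indicator (fun _ => (1 : ℝ≥0∞)) with hshellInd
  set C0 : Set (Measure (EuclideanSpace ℝ (Fin 3))) :=
    {μ' : Measure (EuclideanSpace ℝ (Fin 3)) | (μ', (0 : EuclideanSpace ℝ (Fin 3))) ∈ C} with hC0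
  set nC : Measure (EuclideanSpace ℝ (Fin 3)) → ℝ≥0∞ :=
    fun μ => ∫⁻ y, C.indicator (fun p => shellInd p.2) (μ, y) ∂μ with hnC
  set wC : Measure (EuclideanSpace ℝ (Fin 3)) → ℝ≥0∞ :=
    fun μ => ∫⁻ y, C.indicator (fun p => w p.2) (μ, y) ∂μ with hwC
  set G : Measure (EuclideanSpace ℝ (Fin 3)) → Prop := fun μ => ∃ a : ℝ, 9 / 10 ≤ a ∧ a ≤ 1 ∧
      ∃ T : Finset (EuclideanSpace ℝ (Fin 3)),
        (↑T : Set (EuclideanSpace ℝ (Fin 3))) =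
          {y : EuclideanSpace ℝ (Fin 3) | μ {y} ≠ 0 ∧ y ≠ 0 ∧ ‖y‖ ≤ 5 / 4 * a} ∧
        (ShellCloseTo (a / 100) T (Finset.image (fun v : EuclideanSpace ℝ (Fin 3) => a • v) fccKissingPattern) ∨
          ShellCloseTo (a / 100) T (Finset.image (fun v : EuclideanSpace ℝ (Fin 3) => a • v) hcpKissingPattern))
    with hG
  -- measurability facts
  have hshellm : Measurable shellInd := by
    refine measurable_one.indicator ?_
    exact (measurableSet_lt measurable_const measurable_norm).inter
      (measurableSet_lt measurable_norm measurable_const)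
  have hshellS : MeasurableSet ({z : EuclideanSpace ℝ (Fin 3) | 0 < ‖z‖ ∧ ‖z‖ < 6 / 5}) :=
    (measurableSet_lt measurable_const measurable_norm).inter (measurableSet_lt measurable_norm measurable_const)
  have hshelleven : ∀ y, shellInd (-y) = shellInd y := fun y => by
    rw [hshellInd]
    exact shellIndicator_neg y
  have hC0m : MeasurableSet C0 := measurable_prodMk_right hCm
  have hkn : Measurable (Function.uncurry fun (μ : Measure (EuclideanSpace ℝ (Fin 3))) (y : EuclideanSpace ℝ (Fin 3)) =>
      C.indicator (fun p => shellInd p.2) (μ, y)) := by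
    have : (Function.uncurry fun (μ : Measure (EuclideanSpace ℝ (Fin 3))) (y : EuclideanSpace ℝ (Fin 3)) =>
        C.indicator (fun p => shellInd p.2) (μ, y)) = C.indicator (fun p => shellInd p.2) := by
      funext p; rfl
    rw [this]
    exact (hshellm.comp measurable_snd).indicator hCm
  have hkw : Measurable (Function.uncurry fun (μ : Measure (EuclideanSpace ℝ (Fin 3))) (y : EuclideanSpace ℝ (Fin 3)) =>
      C.indicator (fun p => w p.2) (μ, y)) := by
    have : (Function.uncurry fun (μ : Measure (EuclideanSpace ℝ (Fin 3))) (y : EuclideanSpace ℝ (Fin 3)) =>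
        C.indicator (fun p => w p.2) (μ, y)) = C.indicator (fun p => w p.2) := by
      funext p; rfl
    rw [this]
    exact (hwm.comp measurable_snd).indicator hCm
  obtain ⟨ΦN, hΦNm, hΦN⟩ := MarkMeasurable.stub_markMeasurable δ hδ _ hkn
  obtain ⟨ΦW, hΦWm, hΦW⟩ := MarkMeasurable.stub_markMeasurable δ hδ _ hkw
  -- a.s.: twelve neighbours, hence `nC ≤ 12`, and `wC ≤ W`
  have h12 : ∀ᵐ μ ∂P, ∫⁻ y, shellInd y ∂μ = 12 := by
    filter_upwards [hcore, hchart] with μ hc hch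
    obtain ⟨S, rfl, hgood, -⟩ := hch
    obtain ⟨S₀, h0, -, hμ⟩ := hc
    have h0S : (0 : EuclideanSpace ℝ (Fin 3)) ∈ S := by
      have h1 : (Measure.count : Measure (EuclideanSpace ℝ (Fin 3))).restrict S {0} ≠ 0 := by
        rw [hμ]
        exact (count_restrict_singleton_ne_zero_iff S₀ 0).2 h0
      exact (count_restrict_singleton_ne_zero_iff S 0).1 h1
    rw [lintegral_indicator_const hshellS, one_mul]
    exact TwelveNeighbours.stub_twelveNeighbours S (hgood 0 h0S)
  have hnC_le : ∀ μ : Measure (EuclideanSpace ℝ (Fin 3)), nC μ ≤ ∫⁻ y, shellInd y ∂μ := by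
    intro μ
    refine lintegral_mono fun y => ?_
    by_cases hy : (μ, y) ∈ C
    · simp only [Set.indicator_of_mem hy, le_refl]
    · simp only [Set.indicator_of_notMem hy, zero_le]
  have hwC_le : ∀ μ : Measure (EuclideanSpace ℝ (Fin 3)), wC μ ≤ ∫⁻ y, w y ∂μ := by
    intro μ
    refine lintegral_mono fun y => ?_
    by_cases hy : (μ, y) ∈ C
    · simp only [Set.indicator_of_mem hy, le_refl]
    · simp only [Set.indicator_of_notMem hy, zero_le]
  have hnC12 : ∀ᵐ μ ∂P, nC μ ≤ 12 := by
    filter_upwards [h12] with μ hμ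
    exact (hnC_le μ).trans hμ.le
  have hwCW : ∀ᵐ μ ∂P, wC μ ≤ ENNReal.ofReal W := by
    filter_upwards [hcore] with μ hc
    exact (hwC_le μ).trans (hwW μ hc)
  -- a.e.-measurability of the mark functionals
  have hnCae : nC =ᵐ[P] ΦN := by
    filter_upwards [hcore] with μ hc
    exact (hΦN μ hc).symm
  have hwCae : wC =ᵐ[P] ΦW := by
    filter_upwards [hcore] with μ hc
    exact (hΦW μ hc).symm
  have hnCm : AEMeasurable nC P := ⟨ΦN, hΦNm, hnCae⟩
  have hwCm : AEMeasurable wC P := ⟨ΦW, hΦWm, hwCae⟩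
  -- the two Mecke computations
  have hMeckeN : ∫⁻ μ, nC μ ∂P = 12 * P C0 := by
    have h1 := CovariantMecke.stub_covariantMecke P hstat C hCm hCcov shellInd hshellm hshelleven
    rw [show (fun μ => nC μ) = fun μ => ∫⁻ y, C.indicator (fun p => shellInd p.2) (μ, y) ∂μ from rfl] at *
    rw [h1]
    calc ∫⁻ μ, C0.indicator (fun _ => (1 : ℝ≥0∞)) μ * ∫⁻ y, shellInd y ∂μ ∂P
        = ∫⁻ μ, C0.indicator (fun _ => (12 : ℝ≥0∞)) μ ∂P := by
          refine lintegral_congr_ae ?_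
          filter_upwards [h12] with μ hμ
          rw [hμ]
          by_cases hm : μ ∈ C0
          · simp only [Set.indicator_of_mem hm, one_mul]
          · simp only [Set.indicator_of_notMem hm, zero_mul]
      _ = 12 * P C0 := lintegral_indicator_const hC0m 12
  have hMeckeW : ∫⁻ μ, wC μ ∂P ≤ ENNReal.ofReal W * P C0 := by
    have h1 := CovariantMecke.stub_covariantMecke P hstat C hCm hCcov w hwm hweven
    rw [show (fun μ => wC μ) = fun μ => ∫⁻ y, C.indicator (fun p => w p.2) (μ, y) ∂μ from rfl] at *
    rw [h1]
    calc ∫⁻ μ, C0.indicator (fun _ => (1 : ℝ≥0∞)) μ * ∫⁻ y, w y ∂μ ∂P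
        ≤ ∫⁻ μ, C0.indicator (fun _ => ENNReal.ofReal W) μ ∂P := by
          refine lintegral_mono_ae ?_
          filter_upwards [hcore] with μ hc
          by_cases hm : μ ∈ C0
          · simp only [Set.indicator_of_mem hm, one_mul]
            exact hwW μ hc
          · simp only [Set.indicator_of_notMem hm, zero_mul, le_refl]
      _ = ENNReal.ofReal W * P C0 := lintegral_indicator_const hC0m _
  -- finiteness and real versions
  have hPC0 : P C0 ≠ ∞ := measure_ne_top P _
  have hnC_int : ∫ μ, (nC μ).toReal ∂P = 12 * (P C0).toReal := by
    rw [integral_toReal hnCm (hnC12.mono fun μ hμ => lt_of_le_of_lt hμ (by norm_num)), hMeckeN,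
      ENNReal.toReal_mul]
    norm_num
  have hwC_int : ∫ μ, (wC μ).toReal ∂P ≤ W * (P C0).toReal := by
    rw [integral_toReal hwCm (hwCW.mono fun μ hμ => lt_of_le_of_lt hμ ENNReal.ofReal_lt_top)]
    have : (∫⁻ μ, wC μ ∂P).toReal ≤ (ENNReal.ofReal W * P C0).toReal :=
      ENNReal.toReal_mono (ENNReal.mul_ne_top ENNReal.ofReal_ne_top hPC0) hMeckeW
    rwa [ENNReal.toReal_mul, ENNReal.toReal_ofReal hW0] at this
  -- integrability of the pieces
  have hnC_integrable : Integrable (fun μ => (nC μ).toReal) P := by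
    refine Integrable.mono' (integrable_const (12 : ℝ)) hnCm.ennreal_toReal.aestronglyMeasurable ?_
    filter_upwards [hnC12] with μ hμ
    rw [Real.norm_eq_abs, abs_of_nonneg ENNReal.toReal_nonneg]
    have : (nC μ).toReal ≤ (12 : ℝ≥0∞).toReal := ENNReal.toReal_mono (by norm_num) hμ
    simpa using this
  have hwC_integrable : Integrable (fun μ => (wC μ).toReal) P := by
    refine Integrable.mono' (integrable_const W) hwCm.ennreal_toReal.aestronglyMeasurable ?_
    filter_upwards [hwCW] with μ hμ
    rw [Real.norm_eq_abs, abs_of_nonneg ENNReal.toReal_nonneg]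
    have : (wC μ).toReal ≤ (ENNReal.ofReal W).toReal := ENNReal.toReal_mono ENNReal.ofReal_ne_top hμ
    rwa [ENNReal.toReal_ofReal hW0] at this
  have hind_integrable : Integrable (C0.indicator fun _ => β) P := (integrable_const β).indicator hC0m
  have hind_int : ∫ μ, C0.indicator (fun _ => β) μ ∂P = β * (P C0).toReal := by
    rw [integral_indicator_const β hC0m, smul_eq_mul, measureReal_def, mul_comm]
  -- for every ε: level − ε + κ·P*(bad) ≤ E_P[h]
  have hb : ∀ ε : ℝ, 0 < ε → level - ε + κ * (P {μ | ¬ G μ}).toReal ≤ ∫ μ, (∫ y, lennardJones ‖y‖ ∂μ) / 2 ∂P := by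
    intro ε hε
    obtain ⟨R, M, t, ht, hpt⟩ := hcertε ε hε
    set ℓ : Measure (EuclideanSpace ℝ (Fin 3)) → ℝ := fun μ =>
      level - ε + α * (nC μ).toReal - C0.indicator (fun _ => β) μ - (wC μ).toReal with hℓ
    have hℓi : Integrable ℓ P :=
      (((integrable_const (level - ε)).add (hnC_integrable.const_mul α)).sub hind_integrable).sub hwC_integrable
    have hae : ∀ᵐ μ ∂P,
        (ℓ μ ≤ (∫ y, lennardJones ‖y‖ ∂μ) / 2 + ∫ y, (t μ y - t (Measure.map (fun z => z - y) μ) (-y)) ∂μ) ∧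
        (¬ G μ → ℓ μ + κ ≤ (∫ y, lennardJones ‖y‖ ∂μ) / 2 +
            ∫ y, (t μ y - t (Measure.map (fun z => z - y) μ) (-y)) ∂μ) := by
      filter_upwards [hcore, hchart, hFB] with μ hc hch hfb
      exact hpt μ hc hch hfb
    have hprice := LevelPricing.stub_levelPricing δ hδ P hP hcore hstat R M t ht G ℓ hℓi κ hκ.le hae
    -- E_P[ℓ] ≥ level − ε
    have hA : Integrable (fun μ => level - ε + α * (nC μ).toReal - C0.indicator (fun _ => β) μ) P :=
      ((integrable_const _).add (hnC_integrable.const_mul α)).sub hind_integrable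
    have hBf : Integrable (fun μ => level - ε + α * (nC μ).toReal) P :=
      (integrable_const _).add (hnC_integrable.const_mul α)
    have e1 : ∫ μ, ℓ μ ∂P = (∫ μ, (level - ε + α * (nC μ).toReal - C0.indicator (fun _ => β) μ) ∂P) -
        ∫ μ, (wC μ).toReal ∂P := integral_sub hA hwC_integrable
    have e2 : ∫ μ, (level - ε + α * (nC μ).toReal - C0.indicator (fun _ => β) μ) ∂P =
        (∫ μ, (level - ε + α * (nC μ).toReal) ∂P) - ∫ μ, C0.indicator (fun _ => β) μ ∂P :=
      integral_sub hBf hind_integrable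
    have e3 : ∫ μ, (level - ε + α * (nC μ).toReal) ∂P = (∫ _μ, (level - ε) ∂P) + ∫ μ, α * (nC μ).toReal ∂P :=
      integral_add (integrable_const _) (hnC_integrable.const_mul α)
    have e4 : ∫ _μ, (level - ε) ∂P = level - ε := by
      rw [integral_const, probReal_univ, one_smul]
    have e5 : ∫ μ, α * (nC μ).toReal ∂P = α * (12 * (P C0).toReal) := by
      rw [integral_const_mul, hnC_int]
    have hP0 : 0 ≤ (P C0).toReal := ENNReal.toReal_nonneg
    have hkey : (12 * α - β - W) * (P C0).toReal = α * (12 * (P C0).toReal) - β * (P C0).toReal - W * (P C0).toReal := by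
      ring
    have hkey0 : 0 ≤ (12 * α - β - W) * (P C0).toReal := mul_nonneg (by linarith) hP0
    have hℓge : level - ε ≤ ∫ μ, ℓ μ ∂P := by
      rw [e1, e2, e3, e4, e5, hind_int]
      linarith [hwC_int, hkey, hkey0]
    linarith
  -- let ε → 0
  refine le_of_forall_pos_lt_add fun ε hε => ?_
  have := hb (ε / 2) (by positivity)
  linarith

/-- **The crux from the law-free certificate family and crux 9226 (sorry-free)**: `pricedFloor_of_funnelCertificates`, then the
landed `RouteBetaPricedFloor.defectFreeCrystallizes_of_pricedFloor` (priced floor ⇒ R2a″ ⇒ R2a′ ⇒ 9226's hypothesis; P1 good law,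
R1 funnel chart, 9227, R3 charging, item 2916 — all landed).  Glue-by candidate for a split of the crux into
{FunnelCertificates, LayeredLawsSelectHcp}. [folklore] -/
theorem defectFreeCrystallizes_of_funnelCertificates
    (hcert :    ∀ a₀ h₀ : ℝ, 189 / 200 ≤ a₀ → a₀ ≤ 199 / 200 → 77 / 100 ≤ h₀ → h₀ ≤ 163 / 200 →
            (∀ a h : ℝ, 0 < a → 0 < h →
              Summit.AtomisticToContinuum.Crystallization.Theorems.PalmUnimodularRigidity.LayeredLawsSelectHcp.hcpE a₀ h₀ ≤
                Summit.AtomisticToContinuum.Crystallization.Theorems.PalmUnimodularRigidity.LayeredLawsSelectHcp.hcpE a h) →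
            ∃ κ : ℝ, 0 < κ ∧ ∀ δ : ℝ, 0 < δ →
              ∃ (C : Set (Measure (EuclideanSpace ℝ (Fin 3)) × EuclideanSpace ℝ (Fin 3)))
                (w : EuclideanSpace ℝ (Fin 3) → ℝ≥0∞) (α β W : ℝ),
                MeasurableSet C ∧
                (∀ (μ : Measure (EuclideanSpace ℝ (Fin 3))) (y : EuclideanSpace ℝ (Fin 3)),
                  (Measure.map (fun z => z - y) μ, -y) ∈ C ↔ (μ, (0 : EuclideanSpace ℝ (Fin 3))) ∈ C) ∧
                Measurable w ∧ (∀ y, w (-y) = w y) ∧ 0 ≤ W ∧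
                (∀ μ : Measure (EuclideanSpace ℝ (Fin 3)), IsRootedHardCore δ μ → ∫⁻ y, w y ∂μ ≤ ENNReal.ofReal W) ∧
                0 ≤ α ∧ 0 ≤ β ∧ β + W ≤ 12 * α ∧
                ∀ ε : ℝ, 0 < ε →
                  ∃ R M : ℝ, ∃ t : Measure (EuclideanSpace ℝ (Fin 3)) → EuclideanSpace ℝ (Fin 3) → ℝ,
                    (Measurable (Function.uncurry t) ∧ (∀ μ y, |t μ y| ≤ M) ∧ ∀ μ y, R < ‖y‖ → t μ y = 0) ∧
                    ∀ μ : Measure (EuclideanSpace ℝ (Fin 3)), IsRootedHardCore δ μ →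
                      (∃ S : Set (EuclideanSpace ℝ (Fin 3)),
                        μ = (Measure.count : Measure (EuclideanSpace ℝ (Fin 3))).restrict S ∧
                        (∀ y ∈ S, SetGood S y) ∧
                        ∃ s : ℤ → ℤ, IsHaggSeq s ∧
                          ∃ Φ : EuclideanSpace ℝ (Fin 3) → EuclideanSpace ℝ (Fin 3),
                            Set.BijOn Φ (barlowStacking 1 (Real.sqrt (2 / 3)) s) S ∧
                            ∀ p ∈ barlowStacking 1 (Real.sqrt (2 / 3)) s, ∀ q ∈ barlowStacking 1 (Real.sqrt (2 / 3)) s,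
                              (dist p q = 1 ↔ (0 < dist (Φ p) (Φ q) ∧ dist (Φ p) (Φ q) < 6 / 5))) →
                      (∃ S : Set (EuclideanSpace ℝ (Fin 3)),
                        μ = (Measure.count : Measure (EuclideanSpace ℝ (Fin 3))).restrict S ∧
                        ∀ p ∈ S, HasSum (fun q : {q : EuclideanSpace ℝ (Fin 3) // q ∈ S ∧ q ≠ p} =>
                          (deriv lennardJones (dist p q.1) / dist p q.1) • (p - q.1)) 0) →
                      (Summit.AtomisticToContinuum.Crystallization.Theorems.PalmUnimodularRigidity.LayeredLawsSelectHcp.hcpE a₀ h₀ - ε +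
                            α * (∫⁻ y, C.indicator (fun p => ({z : EuclideanSpace ℝ (Fin 3) | 0 < ‖z‖ ∧ ‖z‖ < 6 / 5}).indicator
                              (fun _ => (1 : ℝ≥0∞)) p.2) (μ, y) ∂μ).toReal -
                            {μ' : Measure (EuclideanSpace ℝ (Fin 3)) | (μ', (0 : EuclideanSpace ℝ (Fin 3))) ∈ C}.indicator
                              (fun _ => β) μ -
                            (∫⁻ y, C.indicator (fun p => w p.2) (μ, y) ∂μ).toReal ≤
                          (∫ y, lennardJones ‖y‖ ∂μ) / 2 + ∫ y, (t μ y - t (Measure.map (fun z => z - y) μ) (-y)) ∂μ) ∧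
                      ((¬ ∃ a : ℝ, 9 / 10 ≤ a ∧ a ≤ 1 ∧ ∃ T : Finset (EuclideanSpace ℝ (Fin 3)),
                          (↑T : Set (EuclideanSpace ℝ (Fin 3))) =
                            {y : EuclideanSpace ℝ (Fin 3) | μ {y} ≠ 0 ∧ y ≠ 0 ∧ ‖y‖ ≤ 5 / 4 * a} ∧
                          (ShellCloseTo (a / 100) T (Finset.image (fun v : EuclideanSpace ℝ (Fin 3) => a • v) fccKissingPattern) ∨
                            ShellCloseTo (a / 100) T
                              (Finset.image (fun v : EuclideanSpace ℝ (Fin 3) => a • v) hcpKissingPattern))) →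
                        Summit.AtomisticToContinuum.Crystallization.Theorems.PalmUnimodularRigidity.LayeredLawsSelectHcp.hcpE a₀ h₀ - ε +
                              α * (∫⁻ y, C.indicator (fun p => ({z : EuclideanSpace ℝ (Fin 3) | 0 < ‖z‖ ∧ ‖z‖ < 6 / 5}).indicator
                                (fun _ => (1 : ℝ≥0∞)) p.2) (μ, y) ∂μ).toReal -
                              {μ' : Measure (EuclideanSpace ℝ (Fin 3)) | (μ', (0 : EuclideanSpace ℝ (Fin 3))) ∈ C}.indicator
                                (fun _ => β) μ -
                              (∫⁻ y, C.indicator (fun p => w p.2) (μ, y) ∂μ).toReal + κ ≤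
                          (∫ y, lennardJones ‖y‖ ∂μ) / 2 + ∫ y, (t μ y - t (Measure.map (fun z => z - y) μ) (-y)) ∂μ) )
    (h9226 : PalmUnimodularRigidity.LayeredLawsSelectHcp) :
    Summit.AtomisticToContinuum.Crystallization.Theses.ReggeStarCoercivity.DefectFreeCrystallizes :=
  RouteBetaPricedFloor.defectFreeCrystallizes_of_pricedFloor (pricedFloor_of_funnelCertificates hcert) h9226

end Summit.AtomisticToContinuum.Crystallization.Theorems.PalmGoodLaw.RouteBetaLawFree

end
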